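/-
Copyright (c) 2026 the pub-hodgecm-mathlib formalisation cell (harness21).  Prover seat hodgecm-mathlib-LH4-p10 (g3): dealer LH4-plan (g12) WORD #1 (4)(ii) «DEFS LEAF №1-R2»
under the (R-22) «κS-RECUT» (heir LEAD F0P3a-plan (g19) T18-50 (d); pen SHAPE MEMO v1 668606e998450a1b §2–§3; REF5 (g22) R5-109 (3), R5-114, R5-115).  2026-09-04.
-/
import Summits.HodgeConjecture.HodgeConjecture.Theorems.F0P3cDyRamFourFrameLawDefsR   -- ★ DEFS LEAF №1-R (p855074): `KappaSignLawS∕AtS shift`, `shiftR`, `KappaAmplitudeLawAtS∕AtR`, `FourFrameLawsWildAtS`, …; brings ★ №1 (p854575)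
import HarnessLib

/-!
# F0 · P3c · line LH4 «(D-RAM) FOUR-FRAME» — DEFS LEAF №1-R2 «κ-SIGN LAW, Ω-AWARE» (R-22 κS-RECUT): the κ-sign law of ★ №1-R with an extra sign TOKEN SCHEDULE `Ω`,
# its place-wise cuts and `Iff.rfl` ties, the custody tie `Ω ≡ 1 ↦ №1-R`, the token-congruence bridge, and the R2-names at the re-cut shift `shiftR`

WHY (R-22).  The κ-SIGN law of record K-SGN-R (★ №1-R `KappaSignLawAtR`, sign `S_i = baseSign σ i · normSign σ (fPartProd δ (a, b, 1) i)`) is PAPER-REFUTED AS TYPED at the datum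
`(d, t) = (6, 8)`, `e_F = 4` (REF5 (g22) R5-109 (3); confirm-or-break tally «=»: LH4-p05 (g3), LH4-p04 (g2) + ★ p856880, LH4-r01 (g4) GD∕GD2, LHref-N #343): on the glued strata a
further sign `Ω` — the norm class of a `σ`-fixed representative of the glue unit of the axis — enters, and it is `1` exactly on the COVERED set of record (`d` odd, or `2d ≤ t + 2`;
REF5 R5-114∕R5-115 (1): NOT at `d = t ≥ 4` for type 2).  The pen's SHAPE MEMO v1 (§2) re-letters the sign half with the factor `Ωtok i` in front of `S_i`.
DESIGN (the ★ №1-R precedent: never re-word a ★ def in place; keep every token refutable and SCHEDULED).  Exactly as №1-R turned the depth shift into a schedule `shift d t`, this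
leaf turns the new sign token into a SCHEDULE PARAMETER `Ω : OmegaSchedule` — a function of the datum `(K, σ, ϖ, d)`, the roots `(a, b)` and the slot `i` (T18-53: `K` explicit so that schedule arguments are never eta-expanded; no `t`), with values in `ℤ`:
* §S2 `KappaSignLawS2 shift Ω N₀ τ` ∕ `KappaSignLawAtS2 shift Ω N₀ τ σ ϖ d t` — ★ №1-R `KappaSignLawS∕AtS` VERBATIM except the RHS sign `S_i ↦ Ω K σ ϖ d a b i * S_i`; `Iff.rfl` tie;
  the fenced conjunction `FourFrameLawsWildAtS2 shift Ω N₀ τ` = fence (★ №1 (S)At ∧ ★ №1-R (K-ABS-S)At ∧ (K-SGN-S2)At) and its closed form — the (S) and (K-ABS) halves are NOT re-cut;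
* §T the TRIVIAL TOKEN `omegaOne ≡ 1` and the CUSTODY TIE `KappaSignLawAtS2 shift omegaOne ↔ KappaSignLawAtS shift` (so every value ever checked for K-SGN∕K-SGN-R is a value of the
  S2-family), and the TOKEN CONGRUENCE: two schedules that agree on every admissible `(δ, a, b, n, i)` of a datum give the same cut there (`kappaSignLawAtS2_iff_of_forall_eq`) — whence the
  COVERED-SET BRIDGE SHAPE `kappaSignLawAtS2_iff_kappaSignLawAtS_of_forall_eq_one`: wherever the token is provably `1` the re-cut law IS the law of record (the Ω-defs leaf of
  LH4-p04 (g2) supplies «covered ⇒ token = 1»; this leaf does not import it and asserts nothing about any concrete token);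
* §R2 the R2-NAMES at the re-cut shift: `KappaSignLawR2 Ω`, `KappaSignLawAtR2 Ω N₀ τ σ ϖ d t := KappaSignLawAtS2 shiftR Ω N₀ τ σ ϖ d t`, `FourFrameLawsWildAtR2 ∕ WildR2 ∕ WildOfRecordR2 Ω`,
  `Iff.rfl` unfoldings, the R-level bridges; the U3 «κS-RECUT» edition instantiates `Ω := ΩR` (the glue-sign schedule of record, typed over LH4-p04 (g2)'s `glueSign` with REF5 R5-115 (2)'s
  symmetric units `(b, a, b ∕ a)` — NOT in this file, so that this leaf and the K-SGN-R2 transport head are independent of the Ω-defs leaf and a later re-fit changes `ΩR` only).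
DEF LANE: `def`s + `Iff.rfl`∕one-rewrite ties only; no instance, no notation, no sorry, no law asserted.  EVERY PROP HERE IS A CENSUS LAW — an empirical regularity, a PROVER TARGET,
never a literature fact.  RISK LINE (R-22, verbatim from the tally): «Ω-token certified at (6,8) and e2b (4,4) by paper + GD2; type-2 twin and the equilateral corner (R5-115 (4)) pending».
HONEST LABEL: HC_CM is proved only modulo the 7 printed citations (2 remaining: hLiu418 = stmt-HodgeConjecture-24832, h413 = stmt-HodgeConjecture-24833) until rung 0 closes;
this file asserts nothing (count-neutral vehicle).

## References
* [Rogawski1990] J. D. Rogawski, *Automorphic Representations of Unitary Groups in Three Variables*, Ann. of Math. Stud. 123 (1990): §4.9 Prop. 4.9.1 (a) p. 55, §12.2.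
* [LanglandsShelstad1987] R. P. Langlands, D. Shelstad, *On the definition of transfer factors*, Math. Ann. 278 (1987), §1.3, §3 (the κ-signs of the classes in a stable class).
* [Serre1979] J.-P. Serre, *Local Fields*, GTM 67 (1979): Ch. V §3 Prop. 5, Cor. 3 (norm subgroups and unit filtration of a ramified quadratic extension), Ch. XV §2.
-/

noncomputable section

namespace Summit.HodgeConjecture.HodgeConjecture.Cruxes.H413.F0P3cDyRamFourFrameLawDefsR2

open scoped Valued WithZero Matrix MatrixGroups
open Finset Classical
open Literature.NumberTheory.Automorphic Literature.NumberTheory.Automorphic.HermitianLattice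
  Literature.NumberTheory.Automorphic.UnitaryLatticeTree Literature.NumberTheory.Automorphic.UnitaryThreeFourFrame
open Summit.HodgeConjecture.HodgeConjecture.Cruxes.H413.F0P3cDyRamFourFrameLawDefs
open Summit.HodgeConjecture.HodgeConjecture.Cruxes.H413.F0P3cDyRamFourFrameLawDefsR

/-! ## §Ω  The type of sign-token schedules -/

/-- Ω · A SIGN-TOKEN SCHEDULE: an integer `Ω K σ ϖ d a b i` attached to a datum `(K, σ, ϖ, d, t)`, a pair of roots `(a, b)` of the square family and a slot `i : Fin 3` (the R-22
re-cut reads it as the norm class of a `σ`-fixed representative of the glue unit of axis `i`; this leaf keeps it ABSTRACT — any schedule).  [cite: LanglandsShelstad1987, §1.3] -/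
abbrev OmegaSchedule : Type 1 :=
  ∀ (K : Type) [Field K] [Valued K ℤᵐ⁰], (K →+* K) → K → ℕ → K → K → Fin 3 → ℤ

/-- Ω₁ · THE TRIVIAL TOKEN `Ω ≡ 1` (the schedule of record before R-22: at it the S2-family IS ★ №1-R's S-family, §T). [cite: LanglandsShelstad1987, §1.3] -/
def omegaOne : OmegaSchedule := fun _ _ _ _ _ _ _ _ _ => 1

/-! ## §S2  The κ-sign law with BOTH tokens scheduled: depth shift `shift d t` (★ №1-R) and sign token `Ω K σ ϖ d a b i` (R-22) -/

/-- K-SGN-S2 · the κ-SIGN LAW of ★ №1-R (`KappaSignLawS shift N₀ τ`) with the RHS sign `S_i ↦ Ω K σ ϖ d a b i * S_i`, `S_i = baseSign σ i * normSign σ (fPartProd δ ![a, b, 1] i)`; every other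
token VERBATIM.  CENSUS LAW — empirical, a PROVER TARGET, nothing asserted. [cite: Rogawski1990, §4.9 Prop. 4.9.1 (a) p. 55] [cite: LanglandsShelstad1987, §1.3] -/
def KappaSignLawS2 (shift : ℕ → ℕ → ℤ) (Ω : OmegaSchedule) (N₀ : ℕ → ℕ) (τ : ℕ → ℤ) : Prop :=
  ∀ {K : Type} [Field K] [Valued K ℤᵐ⁰] [CompleteSpace K] [Fintype 𝓀[K]] (σ : K →+* K) (ϖ : K) (d t : ℕ),
    IsRamifiedQuadraticDatum σ ϖ d t →
    ∀ (f : Fin 4 → Fin 3 → (Fin 3 → K)), IsFourFrameFamily σ f →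
    ∀ (δ : K), σ δ = -δ → δ ≠ 0 →
    ∀ (a b : K), a * σ a = 1 → b * σ b = 1 → Valued.v (a - 1) < Valued.v (2 : K) → Valued.v (b - 1) < Valued.v (2 : K) →
    ∀ (n₁ n₂ n₃ : ℕ), IsElementDatum σ ϖ (N₀ d) (a * a) (b * b) n₁ n₂ n₃ →
    ∀ (Γ : Fin 4 → GL (Fin 3) K), (∀ b', (Γ b' : Matrix (Fin 3) (Fin 3) K) = frameElt σ f b' (a * a) (b * b)) →
    ∀ (k : ℕ), 2 * k + d = n₁ + n₂ + n₃ + 2 →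
    ∀ (i : Fin 3) (B : ℤ), 2 * B = ((![n₁, n₂, n₃] : Fin 3 → ℕ) i : ℤ) - d + 2 - 2 * shift d t →
      ((∑ b' : Fin 4, kappaChar i b' * (fixedVertexCount σ ϖ 0 (Γ b') : ℤ) : ℤ) : ℚ) =
          (Ω K σ ϖ d a b i * (baseSign σ i * normSign σ (fPartProd δ ![a, b, 1] i)) : ℤ) * ampl (Fintype.card 𝓀[K]) k B ∧
      ((∑ b' : Fin 4, kappaChar i b' * (fixedVertexCount σ ϖ 2 (Γ b') : ℤ) : ℤ) : ℚ) =
          (Ω K σ ϖ d a b i * (baseSign σ i * normSign σ (fPartProd δ ![a, b, 1] i)) : ℤ) * ampl (Fintype.card 𝓀[K]) k (B + τ d)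

/-- K-SGN-S2-At · `KappaSignLawS2 shift Ω N₀ τ` AT ONE DATUM (★ №1-R `KappaSignLawAtS` with the sign `Ω K σ ϖ d a b i * S_i`). [cite: Rogawski1990, §4.9 Prop. 4.9.1 (a) p. 55] -/
def KappaSignLawAtS2 {K : Type} [Field K] [Valued K ℤᵐ⁰] [CompleteSpace K] [Fintype 𝓀[K]] (shift : ℕ → ℕ → ℤ) (Ω : OmegaSchedule) (N₀ : ℕ → ℕ) (τ : ℕ → ℤ)
    (σ : K →+* K) (ϖ : K) (d t : ℕ) : Prop :=
    IsRamifiedQuadraticDatum σ ϖ d t →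
    ∀ (f : Fin 4 → Fin 3 → (Fin 3 → K)), IsFourFrameFamily σ f →
    ∀ (δ : K), σ δ = -δ → δ ≠ 0 →
    ∀ (a b : K), a * σ a = 1 → b * σ b = 1 → Valued.v (a - 1) < Valued.v (2 : K) → Valued.v (b - 1) < Valued.v (2 : K) →
    ∀ (n₁ n₂ n₃ : ℕ), IsElementDatum σ ϖ (N₀ d) (a * a) (b * b) n₁ n₂ n₃ →
    ∀ (Γ : Fin 4 → GL (Fin 3) K), (∀ b', (Γ b' : Matrix (Fin 3) (Fin 3) K) = frameElt σ f b' (a * a) (b * b)) →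
    ∀ (k : ℕ), 2 * k + d = n₁ + n₂ + n₃ + 2 →
    ∀ (i : Fin 3) (B : ℤ), 2 * B = ((![n₁, n₂, n₃] : Fin 3 → ℕ) i : ℤ) - d + 2 - 2 * shift d t →
      ((∑ b' : Fin 4, kappaChar i b' * (fixedVertexCount σ ϖ 0 (Γ b') : ℤ) : ℤ) : ℚ) =
          (Ω K σ ϖ d a b i * (baseSign σ i * normSign σ (fPartProd δ ![a, b, 1] i)) : ℤ) * ampl (Fintype.card 𝓀[K]) k B ∧
      ((∑ b' : Fin 4, kappaChar i b' * (fixedVertexCount σ ϖ 2 (Γ b') : ℤ) : ℤ) : ℚ) =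
          (Ω K σ ϖ d a b i * (baseSign σ i * normSign σ (fPartProd δ ![a, b, 1] i)) : ℤ) * ampl (Fintype.card 𝓀[K]) k (B + τ d)

/-- (S1)-S2 tie · the closed `KappaSignLawS2` IS the conjunction of its place-wise cuts — `Iff.rfl`. [cite: Rogawski1990, §4.9 Prop. 4.9.1 (a) p. 55] -/
theorem kappaSignLawS2_iff_forall_at (shift : ℕ → ℕ → ℤ) (Ω : OmegaSchedule) (N₀ : ℕ → ℕ) (τ : ℕ → ℤ) :
    KappaSignLawS2 shift Ω N₀ τ ↔
      ∀ {K : Type} [Field K] [Valued K ℤᵐ⁰] [CompleteSpace K] [Fintype 𝓀[K]] (σ : K →+* K) (ϖ : K) (d t : ℕ), KappaSignLawAtS2 shift Ω N₀ τ σ ϖ d t :=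
  Iff.rfl

/-- W-S2-At · the fenced conjunction (S)At ∧ (K-ABS-S)At ∧ (K-SGN-S2)At at one datum — ★ №1's stable cut and ★ №1-R's κ-amplitude cut UNCHANGED, only the sign half re-tokened.
[cite: Rogawski1990, §4.9 Prop. 4.9.1 (a) p. 55] -/
def FourFrameLawsWildAtS2 {K : Type} [Field K] [Valued K ℤᵐ⁰] [CompleteSpace K] [Fintype 𝓀[K]] (shift : ℕ → ℕ → ℤ) (Ω : OmegaSchedule) (N₀ : ℕ → ℕ) (τ : ℕ → ℤ)
    (σ : K →+* K) (ϖ : K) (d t : ℕ) : Prop :=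
    DyadicFence (K := K) (StableLawAt N₀ σ ϖ d t ∧ KappaAmplitudeLawAtS shift N₀ τ σ ϖ d t ∧ KappaSignLawAtS2 shift Ω N₀ τ σ ϖ d t)

/-- W-S2 · the fenced laws at every complete datum with finite residue field, doubly-scheduled version. [cite: Rogawski1990, §4.9 Prop. 4.9.1 (a) p. 55] -/
def FourFrameLawsWildS2 (shift : ℕ → ℕ → ℤ) (Ω : OmegaSchedule) (N₀ : ℕ → ℕ) (τ : ℕ → ℤ) : Prop :=
    ∀ {K : Type} [Field K] [Valued K ℤᵐ⁰] [CompleteSpace K] [Fintype 𝓀[K]] (σ : K →+* K) (ϖ : K) (d t : ℕ), FourFrameLawsWildAtS2 shift Ω N₀ τ σ ϖ d t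

/-- W-S2 · unfolding `FourFrameLawsWildAtS2` — `Iff.rfl`. [cite: Rogawski1990, §4.9 Prop. 4.9.1 (a) p. 55] -/
theorem fourFrameLawsWildAtS2_iff {K : Type} [Field K] [Valued K ℤᵐ⁰] [CompleteSpace K] [Fintype 𝓀[K]] (shift : ℕ → ℕ → ℤ) (Ω : OmegaSchedule) (N₀ : ℕ → ℕ) (τ : ℕ → ℤ)
    (σ : K →+* K) (ϖ : K) (d t : ℕ) :
    FourFrameLawsWildAtS2 shift Ω N₀ τ σ ϖ d t ↔
      DyadicFence (K := K) (StableLawAt N₀ σ ϖ d t ∧ KappaAmplitudeLawAtS shift N₀ τ σ ϖ d t ∧ KappaSignLawAtS2 shift Ω N₀ τ σ ϖ d t) :=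
  Iff.rfl

/-- W-S2 · the closed laws imply the fenced wild conjunction (the fence and the cuts only weaken). [cite: Rogawski1990, §4.9 Prop. 4.9.1 (a) p. 55] -/
theorem fourFrameLawsWildS2_of_laws (shift : ℕ → ℕ → ℤ) (Ω : OmegaSchedule) (N₀ : ℕ → ℕ) (τ : ℕ → ℤ)
    (hS : StableLaw N₀) (hKA : KappaAmplitudeLawS shift N₀ τ) (hKS : KappaSignLawS2 shift Ω N₀ τ) : FourFrameLawsWildS2 shift Ω N₀ τ :=
  fun σ ϖ d t => dyadicFence_of ⟨hS σ ϖ d t, hKA σ ϖ d t, hKS σ ϖ d t⟩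

/-! ## §T  The custody tie to ★ №1-R at the trivial token, and the token congruence ∕ covered-set bridge shape -/

/-- TOKEN CONGRUENCE · two sign-token schedules that AGREE on every admissible `(δ, a, b, n₁, n₂, n₃, i)` of the datum (behind the datum, the skew `δ ≠ 0`, the roots in `E¹` under the
root guard, the element datum at `N₀ d`) give the SAME κ-sign cut at that datum.  The one lemma behind the custody tie and the covered-set bridge. [cite: LanglandsShelstad1987, §1.3] -/
theorem kappaSignLawAtS2_iff_of_forall_eq {K : Type} [Field K] [Valued K ℤᵐ⁰] [CompleteSpace K] [Fintype 𝓀[K]] (shift : ℕ → ℕ → ℤ) (Ω Ω' : OmegaSchedule)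
    (N₀ : ℕ → ℕ) (τ : ℕ → ℤ) (σ : K →+* K) (ϖ : K) (d t : ℕ)
    (hΩ : ∀ (δ a b : K) (n₁ n₂ n₃ : ℕ) (i : Fin 3), IsRamifiedQuadraticDatum σ ϖ d t → σ δ = -δ → δ ≠ 0 → a * σ a = 1 → b * σ b = 1 →
      Valued.v (a - 1) < Valued.v (2 : K) → Valued.v (b - 1) < Valued.v (2 : K) → IsElementDatum σ ϖ (N₀ d) (a * a) (b * b) n₁ n₂ n₃ →
      Ω K σ ϖ d a b i = Ω' K σ ϖ d a b i) :
    KappaSignLawAtS2 shift Ω N₀ τ σ ϖ d t ↔ KappaSignLawAtS2 shift Ω' N₀ τ σ ϖ d t := by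
  constructor
  · intro h hD f hf δ hσδ hδ0 a b ha hb ha1 hb1 n₁ n₂ n₃ hE Γ hΓ k hk i B hB
    rw [← hΩ δ a b n₁ n₂ n₃ i hD hσδ hδ0 ha hb ha1 hb1 hE]
    exact h hD f hf δ hσδ hδ0 a b ha hb ha1 hb1 n₁ n₂ n₃ hE Γ hΓ k hk i B hB
  · intro h hD f hf δ hσδ hδ0 a b ha hb ha1 hb1 n₁ n₂ n₃ hE Γ hΓ k hk i B hB
    rw [hΩ δ a b n₁ n₂ n₃ i hD hσδ hδ0 ha hb ha1 hb1 hE]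
    exact h hD f hf δ hσδ hδ0 a b ha hb ha1 hb1 n₁ n₂ n₃ hE Γ hΓ k hk i B hB

/-- CUSTODY TIE · AT THE TRIVIAL TOKEN THE S2-CUT IS ★ №1-R's S-CUT: `KappaSignLawAtS2 shift omegaOne N₀ τ σ ϖ d t ↔ KappaSignLawAtS shift N₀ τ σ ϖ d t` (`1 * S_i = S_i`) — so the
520 + 14 + 54 checked values of record and every ★ K-SGN row are values of the S2-family. [cite: Rogawski1990, §4.9 Prop. 4.9.1 (a) p. 55] -/
theorem kappaSignLawAtS2_omegaOne_iff {K : Type} [Field K] [Valued K ℤᵐ⁰] [CompleteSpace K] [Fintype 𝓀[K]] (shift : ℕ → ℕ → ℤ) (N₀ : ℕ → ℕ) (τ : ℕ → ℤ)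
    (σ : K →+* K) (ϖ : K) (d t : ℕ) :
    KappaSignLawAtS2 shift omegaOne N₀ τ σ ϖ d t ↔ KappaSignLawAtS shift N₀ τ σ ϖ d t := by
  simp only [KappaSignLawAtS2, KappaSignLawAtS, omegaOne, one_mul]

/-- CUSTODY TIE · closed forms: `KappaSignLawS2 shift omegaOne N₀ τ ↔ KappaSignLawS shift N₀ τ`. [cite: Rogawski1990, §4.9 Prop. 4.9.1 (a) p. 55] -/
theorem kappaSignLawS2_omegaOne_iff (shift : ℕ → ℕ → ℤ) (N₀ : ℕ → ℕ) (τ : ℕ → ℤ) : KappaSignLawS2 shift omegaOne N₀ τ ↔ KappaSignLawS shift N₀ τ := by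
  simp only [KappaSignLawS2, KappaSignLawS, omegaOne, one_mul]

/-- **COVERED-SET BRIDGE (shape)** · wherever the token is provably `1` on the admissible data of a datum, THE RE-CUT κ-SIGN CUT IS THE CUT OF RECORD:
`KappaSignLawAtS2 shift Ω N₀ τ σ ϖ d t ↔ KappaSignLawAtS shift N₀ τ σ ϖ d t`.  (The Ω-defs leaf proves «covered `(d, t)` ⇒ token = 1» for the glue-sign schedule; the U3 recut
edition composes the two to recover today's rows of record by a one-line specialisation.) [cite: LanglandsShelstad1987, §1.3] [cite: Serre1979, Ch. V §3 Prop. 5, Cor. 3] -/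
theorem kappaSignLawAtS2_iff_kappaSignLawAtS_of_forall_eq_one {K : Type} [Field K] [Valued K ℤᵐ⁰] [CompleteSpace K] [Fintype 𝓀[K]] (shift : ℕ → ℕ → ℤ) (Ω : OmegaSchedule)
    (N₀ : ℕ → ℕ) (τ : ℕ → ℤ) (σ : K →+* K) (ϖ : K) (d t : ℕ)
    (hΩ : ∀ (δ a b : K) (n₁ n₂ n₃ : ℕ) (i : Fin 3), IsRamifiedQuadraticDatum σ ϖ d t → σ δ = -δ → δ ≠ 0 → a * σ a = 1 → b * σ b = 1 →
      Valued.v (a - 1) < Valued.v (2 : K) → Valued.v (b - 1) < Valued.v (2 : K) → IsElementDatum σ ϖ (N₀ d) (a * a) (b * b) n₁ n₂ n₃ →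
      Ω K σ ϖ d a b i = 1) :
    KappaSignLawAtS2 shift Ω N₀ τ σ ϖ d t ↔ KappaSignLawAtS shift N₀ τ σ ϖ d t :=
  (kappaSignLawAtS2_iff_of_forall_eq shift Ω omegaOne N₀ τ σ ϖ d t hΩ).trans (kappaSignLawAtS2_omegaOne_iff shift N₀ τ σ ϖ d t)

/-! ## §R2  The R2-names: the Ω-aware κ-sign law at the re-cut depth shift `shiftR` (★ №1-R), the fenced conjunction, the closed Prop of record, and the R-level bridges -/

/-- K-SGN-R2 · THE Ω-AWARE RE-CUT κ-SIGN LAW: `KappaSignLawS2 shiftR Ω`.  CENSUS LAW — a PROVER TARGET, nothing asserted. [cite: Rogawski1990, §4.9 Prop. 4.9.1 (a) p. 55] -/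
def KappaSignLawR2 (Ω : OmegaSchedule) (N₀ : ℕ → ℕ) (τ : ℕ → ℤ) : Prop := KappaSignLawS2 shiftR Ω N₀ τ

/-- K-SGN-R2-At · the Ω-aware re-cut κ-sign law at one datum: `KappaSignLawAtS2 shiftR Ω N₀ τ σ ϖ d t` — the Prop the U3 «κS-RECUT» stub `stub_U3_kappaSignLawR2` fences, at
`(Ω, N₀, τ) := (ΩR, depthOfRecord, tauOfRecord)`. [cite: Rogawski1990, §4.9 Prop. 4.9.1 (a) p. 55] -/
def KappaSignLawAtR2 {K : Type} [Field K] [Valued K ℤᵐ⁰] [CompleteSpace K] [Fintype 𝓀[K]] (Ω : OmegaSchedule) (N₀ : ℕ → ℕ) (τ : ℕ → ℤ)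
    (σ : K →+* K) (ϖ : K) (d t : ℕ) : Prop :=
    KappaSignLawAtS2 shiftR Ω N₀ τ σ ϖ d t

/-- (S1)-R2 tie · `KappaSignLawR2 Ω N₀ τ` ↔ its place-wise cuts — `Iff.rfl`. [cite: Rogawski1990, §4.9 Prop. 4.9.1 (a) p. 55] -/
theorem kappaSignLawR2_iff_forall_at (Ω : OmegaSchedule) (N₀ : ℕ → ℕ) (τ : ℕ → ℤ) :
    KappaSignLawR2 Ω N₀ τ ↔ ∀ {K : Type} [Field K] [Valued K ℤᵐ⁰] [CompleteSpace K] [Fintype 𝓀[K]] (σ : K →+* K) (ϖ : K) (d t : ℕ), KappaSignLawAtR2 Ω N₀ τ σ ϖ d t :=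
  Iff.rfl

/-- K-SGN-R2-At · unfolding to the S2-cut at `shiftR` — `Iff.rfl`. [cite: Rogawski1990, §4.9 Prop. 4.9.1 (a) p. 55] -/
theorem kappaSignLawAtR2_iff {K : Type} [Field K] [Valued K ℤᵐ⁰] [CompleteSpace K] [Fintype 𝓀[K]] (Ω : OmegaSchedule) (N₀ : ℕ → ℕ) (τ : ℕ → ℤ)
    (σ : K →+* K) (ϖ : K) (d t : ℕ) :
    KappaSignLawAtR2 Ω N₀ τ σ ϖ d t ↔ KappaSignLawAtS2 shiftR Ω N₀ τ σ ϖ d t :=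
  Iff.rfl

/-- W-R2-At · THE Ω-AWARE RE-CUT FOUR-FRAME LAWS AT ONE WILD DATUM: behind the fence, (S)At ∧ (K-ABS-R)At ∧ (K-SGN-R2)At.  A PROVER TARGET, nothing asserted.
[cite: Rogawski1990, §4.9 Prop. 4.9.1 (a) p. 55] -/
def FourFrameLawsWildAtR2 {K : Type} [Field K] [Valued K ℤᵐ⁰] [CompleteSpace K] [Fintype 𝓀[K]] (Ω : OmegaSchedule) (N₀ : ℕ → ℕ) (τ : ℕ → ℤ)
    (σ : K →+* K) (ϖ : K) (d t : ℕ) : Prop :=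
    FourFrameLawsWildAtS2 shiftR Ω N₀ τ σ ϖ d t

/-- W-R2 · the Ω-aware re-cut fenced laws at every complete datum with finite residue field. [cite: Rogawski1990, §4.9 Prop. 4.9.1 (a) p. 55] -/
def FourFrameLawsWildR2 (Ω : OmegaSchedule) (N₀ : ℕ → ℕ) (τ : ℕ → ℤ) : Prop := FourFrameLawsWildS2 shiftR Ω N₀ τ

/-- (iii-rec)-R2 · the Ω-aware re-cut fenced wild laws AT THE PARAMETERS OF RECORD `(depthOfRecord, tauOfRecord)`, for a given token schedule `Ω` — the closed Prop the U3
«κS-RECUT» edition concludes BY NAME at `Ω := ΩR`. [cite: Rogawski1990, §4.9 Prop. 4.9.1 (a) p. 55] -/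
def FourFrameLawsWildOfRecordR2 (Ω : OmegaSchedule) : Prop := FourFrameLawsWildR2 Ω depthOfRecord tauOfRecord

/-- W-R2 · unfolding: `FourFrameLawsWildAtR2 Ω` is the fenced conjunction of ★ №1's stable cut, ★ №1-R's amplitude R-cut and the sign R2-cut — `Iff.rfl`.
[cite: Rogawski1990, §4.9 Prop. 4.9.1 (a) p. 55] -/
theorem fourFrameLawsWildAtR2_iff {K : Type} [Field K] [Valued K ℤᵐ⁰] [CompleteSpace K] [Fintype 𝓀[K]] (Ω : OmegaSchedule) (N₀ : ℕ → ℕ) (τ : ℕ → ℤ)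
    (σ : K →+* K) (ϖ : K) (d t : ℕ) :
    FourFrameLawsWildAtR2 Ω N₀ τ σ ϖ d t ↔
      DyadicFence (K := K) (StableLawAt N₀ σ ϖ d t ∧ KappaAmplitudeLawAtR N₀ τ σ ϖ d t ∧ KappaSignLawAtR2 Ω N₀ τ σ ϖ d t) :=
  Iff.rfl

/-- (iii-rec)-R2 · unfolding: `FourFrameLawsWildOfRecordR2 Ω` is `FourFrameLawsWildAtR2 Ω depthOfRecord tauOfRecord` at every datum — `Iff.rfl`. [cite: Rogawski1990, §4.9 Prop. 4.9.1 (a) p. 55] -/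
theorem fourFrameLawsWildOfRecordR2_iff (Ω : OmegaSchedule) :
    FourFrameLawsWildOfRecordR2 Ω ↔
      ∀ {K : Type} [Field K] [Valued K ℤᵐ⁰] [CompleteSpace K] [Fintype 𝓀[K]] (σ : K →+* K) (ϖ : K) (d t : ℕ), FourFrameLawsWildAtR2 Ω depthOfRecord tauOfRecord σ ϖ d t :=
  Iff.rfl

/-- W-R2 · the closed re-cut laws imply the Ω-aware re-cut wild conjunction. [cite: Rogawski1990, §4.9 Prop. 4.9.1 (a) p. 55] -/
theorem fourFrameLawsWildR2_of_laws (Ω : OmegaSchedule) (N₀ : ℕ → ℕ) (τ : ℕ → ℤ) (hS : StableLaw N₀) (hKA : KappaAmplitudeLawR N₀ τ) (hKS : KappaSignLawR2 Ω N₀ τ) :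
    FourFrameLawsWildR2 Ω N₀ τ :=
  fourFrameLawsWildS2_of_laws shiftR Ω N₀ τ hS hKA hKS

/-- W-R2 · assembly glue at one datum: the three fenced cuts give `FourFrameLawsWildAtR2` (the shape of U3's in-module R2 assembly `u3_fourFrameLawsWildOfRecordR2_of_kappa`).
[cite: Rogawski1990, §4.9 Prop. 4.9.1 (a) p. 55] -/
theorem fourFrameLawsWildAtR2_of_fenced {K : Type} [Field K] [Valued K ℤᵐ⁰] [CompleteSpace K] [Fintype 𝓀[K]] (Ω : OmegaSchedule) (N₀ : ℕ → ℕ) (τ : ℕ → ℤ)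
    (σ : K →+* K) (ϖ : K) (d t : ℕ) (hS : DyadicFence (K := K) (StableLawAt N₀ σ ϖ d t)) (hKA : DyadicFence (K := K) (KappaAmplitudeLawAtR N₀ τ σ ϖ d t))
    (hKS : DyadicFence (K := K) (KappaSignLawAtR2 Ω N₀ τ σ ϖ d t)) : FourFrameLawsWildAtR2 Ω N₀ τ σ ϖ d t :=
  fun h2 => ⟨hS h2, hKA h2, hKS h2⟩

/-- CUSTODY TIE (R-level) · at the trivial token the R2-cut IS ★ №1-R's R-cut: `KappaSignLawAtR2 omegaOne N₀ τ σ ϖ d t ↔ KappaSignLawAtR N₀ τ σ ϖ d t`.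
[cite: Rogawski1990, §4.9 Prop. 4.9.1 (a) p. 55] -/
theorem kappaSignLawAtR2_omegaOne_iff {K : Type} [Field K] [Valued K ℤᵐ⁰] [CompleteSpace K] [Fintype 𝓀[K]] (N₀ : ℕ → ℕ) (τ : ℕ → ℤ) (σ : K →+* K) (ϖ : K) (d t : ℕ) :
    KappaSignLawAtR2 omegaOne N₀ τ σ ϖ d t ↔ KappaSignLawAtR N₀ τ σ ϖ d t :=
  kappaSignLawAtS2_omegaOne_iff shiftR N₀ τ σ ϖ d t

/-- **COVERED-SET BRIDGE (R-level, shape)** · wherever the token is provably `1` on the admissible data of the datum, `KappaSignLawAtR2 Ω N₀ τ σ ϖ d t ↔ KappaSignLawAtR N₀ τ σ ϖ d t` —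
today's rows of record (`(d, t) ∈ {(2,2), (3,2), (2,4), …}`, all on the covered set `d % 2 = 1 ∨ 2 * d ≤ t + 2` of REF5 R5-114) and the U4 ∕ tier-0 consumers of the sign conjunct get the
token of record back by a one-line specialisation. [cite: LanglandsShelstad1987, §1.3] [cite: Serre1979, Ch. V §3 Prop. 5, Cor. 3] -/
theorem kappaSignLawAtR2_iff_kappaSignLawAtR_of_forall_eq_one {K : Type} [Field K] [Valued K ℤᵐ⁰] [CompleteSpace K] [Fintype 𝓀[K]] (Ω : OmegaSchedule)
    (N₀ : ℕ → ℕ) (τ : ℕ → ℤ) (σ : K →+* K) (ϖ : K) (d t : ℕ)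
    (hΩ : ∀ (δ a b : K) (n₁ n₂ n₃ : ℕ) (i : Fin 3), IsRamifiedQuadraticDatum σ ϖ d t → σ δ = -δ → δ ≠ 0 → a * σ a = 1 → b * σ b = 1 →
      Valued.v (a - 1) < Valued.v (2 : K) → Valued.v (b - 1) < Valued.v (2 : K) → IsElementDatum σ ϖ (N₀ d) (a * a) (b * b) n₁ n₂ n₃ →
      Ω K σ ϖ d a b i = 1) :
    KappaSignLawAtR2 Ω N₀ τ σ ϖ d t ↔ KappaSignLawAtR N₀ τ σ ϖ d t :=
  kappaSignLawAtS2_iff_kappaSignLawAtS_of_forall_eq_one shiftR Ω N₀ τ σ ϖ d t hΩ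

/-- **COVERED-SET BRIDGE for the fenced conjunction (R-level, shape)**: under the same token hypothesis, `FourFrameLawsWildAtR2 Ω N₀ τ σ ϖ d t ↔ FourFrameLawsWildAtR N₀ τ σ ϖ d t`
(★ №1-R).  [cite: LanglandsShelstad1987, §1.3] -/
theorem fourFrameLawsWildAtR2_iff_fourFrameLawsWildAtR_of_forall_eq_one {K : Type} [Field K] [Valued K ℤᵐ⁰] [CompleteSpace K] [Fintype 𝓀[K]] (Ω : OmegaSchedule)
    (N₀ : ℕ → ℕ) (τ : ℕ → ℤ) (σ : K →+* K) (ϖ : K) (d t : ℕ)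
    (hΩ : ∀ (δ a b : K) (n₁ n₂ n₃ : ℕ) (i : Fin 3), IsRamifiedQuadraticDatum σ ϖ d t → σ δ = -δ → δ ≠ 0 → a * σ a = 1 → b * σ b = 1 →
      Valued.v (a - 1) < Valued.v (2 : K) → Valued.v (b - 1) < Valued.v (2 : K) → IsElementDatum σ ϖ (N₀ d) (a * a) (b * b) n₁ n₂ n₃ →
      Ω K σ ϖ d a b i = 1) :
    FourFrameLawsWildAtR2 Ω N₀ τ σ ϖ d t ↔ FourFrameLawsWildAtR N₀ τ σ ϖ d t := by
  have h := kappaSignLawAtR2_iff_kappaSignLawAtR_of_forall_eq_one Ω N₀ τ σ ϖ d t hΩ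
  constructor
  · intro hR2 h2
    obtain ⟨hS, hKA, hKS⟩ := hR2 h2
    exact ⟨hS, hKA, h.1 hKS⟩
  · intro hR h2
    obtain ⟨hS, hKA, hKS⟩ := hR h2
    exact ⟨hS, hKA, h.2 hKS⟩

end Summit.HodgeConjecture.HodgeConjecture.Cruxes.H413.F0P3cDyRamFourFrameLawDefsR2

end
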